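import Mathlib.Algebra.Module.CharacterModule
import Mathlib.RingTheory.TensorProduct.Basic
import Mathlib.RingTheory.PowerSeries.Basic
import HarnessLib

/-!
# Coefficient base change for Pontryagin duals: `X(A ⊗_R S) ≃ₗ[A] A ⊗_R X(S)` for a FROBENIUS `R`-algebra `A`,
# and its power-series lift `𝒪⟦T⟧ → 𝒪'⟦T⟧` (stage (α)+(ω-lift) of the Road-FF coefficient base change)

Cell `bsd-stepL` (run/shared/lean/pub/bsd-stepL/), seat `bsd-stepL-imc-p1` (prover g9, 2026-08-27); `--supports
stmt-BirchSwinnertonDyer-19270 --as helper`; pure algebra over Mathlib (no Literature ∕ Summits import), Theses-free.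
PURPOSE: the deciding Road-FF stub of the orientation-repaired crux `IMCDivAtErratumDataAllR` consumes, per Hida member
`g_m` with coefficient ring `𝒪_m`, an `𝒪_m⟦T⟧`-linear congruence `e_m : (𝒪_m⟦T⟧ ⊗_Λ X^Σ(E))/p^m ≃ X^Σ(A_{g_m})/p^m`
(`P2.RoadFF.fittingCongruenceFrameTwoSlotAt_of_members_descent_le_printed`); its COEFFICIENT HALF is
«`X(𝒪 ⊗ M) ≅ 𝒪 ⊗ X(M)`» (defn-ty1 MEMBER-FACTS-DESIGN §1). Selmer duals are CHARACTER MODULES `X(S) = Hom_ℤ(S, ℚ/ℤ)`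
(Mathlib `CharacterModule`, `A`-action `(a·ψ)(s) = ψ(a·s)`), so once `Sel(M ⊗ 𝒪') ≅ 𝒪'⟦T⟧ ⊗ Sel(M)` (later stages) the
remaining statement is the present one.

* `exists_baseChangeMap` — the `A`-LINEAR comparison `Φ : A ⊗_R X(S) → X(A ⊗_R S)`, `a ⊗ x ↦ (a' ⊗ s ↦ x(t(a a')·s))`,
  for any `R`-linear form `t : A → R` (via `CharacterModule.homEquiv`; `A`-linearity = commutativity of `A`).
* **`exists_characterModule_baseChange_equiv`** ∕ `nonempty_characterModule_baseChange_equiv` — `Φ` is an ISOMORPHISM when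
  `t` is part of FROBENIUS DATA: finite families `b, b' : ι → A` with `a = Σ_i t(a·b'_i)·b_i = Σ_i t(a·b_i)·b'_i` for all
  `a` (an `R`-basis and its `t`-dual); inverse `ψ ↦ Σ_i b'_i ⊗ ψ(b_i ⊗ ·)`. The hypothesis is NECESSARY in general: on
  a basis the two `A`-structures on `X(S)^d` are the regular representation and its transpose, isomorphic iff
  `Hom_R(A, R) ≅ A` as `A`-modules (Frobenius ∕ Gorenstein); for `ℤ_p ⊂ 𝒪_L` it holds because `Hom_{ℤ_p}(𝒪_L, ℤ_p)` is
  free of rank one over the discrete valuation ring `𝒪_L` (stage (ω-base), separate file).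
* `exists_frobeniusData_powerSeries` — Frobenius data lift coefficientwise from `R → A` to `R⟦T⟧ → A⟦T⟧` (Mathlib's
  `PowerSeries.algebraPowerSeries`); `nonempty_characterModule_powerSeries_baseChange_equiv` — the composed Road-FF shape.

THEOREMS ONLY (equivalences as `∃`/`Nonempty` with the defining formula); no definition, no named fact, no `sorry`; nothing
about elliptic curves is asserted. References: Bourbaki, Algèbre II §4 no. 2; Skinner 2016 §2.6 (2-6-1); Castella 2018
erratum (b), Lemma 2.1 (where the coefficient extension enters).
-/

set_option autoImplicit false

noncomputable section

open scoped TensorProduct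

namespace Summit.BirchSwinnertonDyer.Rank1Residual.X11b.CoeffBaseChange

variable {R : Type*} [CommRing R] {A : Type*} [CommRing A] [Algebra R A]
variable {S : Type*} [AddCommGroup S] [Module R S]

/-- **The comparison map `Φ : A ⊗_R X(S) → X(A ⊗_R S)`, `a ⊗ x ↦ (a' ⊗ s ↦ x(t(a a')·s))`**, `R`-linear (via
Mathlib's `CharacterModule.homEquiv`) and `A`-LINEAR (commutativity of `A`). [folklore] -/
theorem exists_baseChangeMap (t : A →ₗ[R] R) :
    ∃ Φ : A ⊗[R] CharacterModule S →ₗ[A] CharacterModule (A ⊗[R] S),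
      ∀ (a : A) (x : CharacterModule S) (a' : A) (s : S),
        Φ (a ⊗ₜ x) (a' ⊗ₜ s) = x (t (a * a') • s) := by
  classical
  -- the family `F a x : A →ₗ[R] X(S)`, `a' ↦ t(a a') • x`, bilinear in `(a, x)`
  let F : A → CharacterModule S → (A →ₗ[R] CharacterModule S) := fun a x ↦
    (LinearMap.lsmul R (CharacterModule S)).flip x ∘ₗ t ∘ₗ LinearMap.mulLeft R a
  have hF : ∀ a x a', F a x a' = t (a * a') • x := fun a x a' ↦ by
    simp [F, LinearMap.mulLeft_apply]
  let B : A →ₗ[R] CharacterModule S →ₗ[R] (A →ₗ[R] CharacterModule S) :=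
    LinearMap.mk₂ R F
      (fun a₁ a₂ x ↦ by ext a'; simp [hF, add_mul, add_smul])
      (fun r a x ↦ by ext a'; simp [hF, mul_smul])
      (fun a x₁ x₂ ↦ by ext a'; simp [hF, smul_add])
      (fun r a x ↦ by ext a'; simp [hF]; rw [smul_comm])
  let Φ₀ : A ⊗[R] CharacterModule S →ₗ[R] CharacterModule (A ⊗[R] S) :=
    TensorProduct.lift (LinearMap.compr₂ B (CharacterModule.homEquiv (R := R) (A := A) (B := S)).toLinearMap)
  have hΦ₀ : ∀ (a : A) (x : CharacterModule S) (a' : A) (s : S),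
      Φ₀ (a ⊗ₜ x) (a' ⊗ₜ s) = x (t (a * a') • s) := by
    intro a x a' s
    simp only [Φ₀, TensorProduct.lift.tmul, LinearMap.compr₂_apply, LinearMap.mk₂_apply, B,
      LinearEquiv.coe_coe]
    change CharacterModule.uncurry (R := R) (F a x) (a' ⊗ₜ s) = _
    rw [CharacterModule.uncurry_apply]
    erw [TensorProduct.liftAddHom_tmul]
  -- `A`-linearity: `Φ₀ (c • z) = c • Φ₀ z`
  have hA : ∀ (c : A) (z : A ⊗[R] CharacterModule S), Φ₀ (c • z) = c • Φ₀ z := by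
    intro c z
    induction z using TensorProduct.induction_on with
    | zero => simp
    | add z₁ z₂ h₁ h₂ => simp [smul_add, map_add, h₁, h₂]
    | tmul a x =>
      rw [TensorProduct.smul_tmul', smul_eq_mul]
      refine DFunLike.ext _ _ fun w ↦ ?_
      induction w using TensorProduct.induction_on with
      | zero => simp
      | add w₁ w₂ h₁ h₂ => simp only [map_add, h₁, h₂]
      | tmul a' s =>
        rw [hΦ₀, CharacterModule.smul_apply, TensorProduct.smul_tmul', smul_eq_mul, hΦ₀,
          show c * a * a' = a * (c * a') by ring]
  exact ⟨{ toFun := Φ₀, map_add' := Φ₀.map_add, map_smul' := hA }, hΦ₀⟩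


/-- **Coefficient base change for Pontryagin duals over a FROBENIUS algebra.** Let `A` be a commutative `R`-algebra with an
`R`-linear form `t : A → R` and finite families `b b' : ι → A` that are mutually dual for the pairing `(x, y) ↦ t(xy)`
(`a = Σ_i t(a·b'_i)·b_i` and `a = Σ_i t(a·b_i)·b'_i` for all `a`; e.g. an `R`-basis and its `t`-dual basis). Then for every
`R`-module `S` the map `a ⊗ x ↦ (a' ⊗ s ↦ x(t(a a')·s))` is an `A`-LINEAR ISOMORPHISM
`A ⊗_R X(S) ≃ X(A ⊗_R S)` of the base-changed Pontryagin dual with the Pontryagin dual of the base change (inverse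
`ψ ↦ Σ_i b'_i ⊗ ψ(b_i ⊗ ·)`). Packaged as an existence statement with the defining formula.
[folklore] -/
theorem exists_characterModule_baseChange_equiv {ι : Type*} [Fintype ι] (t : A →ₗ[R] R) (b b' : ι → A)
    (hb : ∀ a : A, a = ∑ i, t (a * b' i) • b i) (hb' : ∀ a : A, a = ∑ i, t (a * b i) • b' i) :
    ∃ e : A ⊗[R] CharacterModule S ≃ₗ[A] CharacterModule (A ⊗[R] S),
      ∀ (a : A) (x : CharacterModule S) (a' : A) (s : S), e (a ⊗ₜ x) (a' ⊗ₜ s) = x (t (a * a') • s) := by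
  classical
  obtain ⟨Φ, hΦ⟩ := exists_baseChangeMap (S := S) t
  -- the candidate inverse `Ψ ψ = Σ_i b'_i ⊗ ψ(b_i ⊗ ·)`
  let χ : ι → CharacterModule (A ⊗[R] S) → CharacterModule S := fun i ψ ↦
    ψ.comp (TensorProduct.mk R A S (b i)).toAddMonoidHom
  have hχ : ∀ i ψ (s : S), χ i ψ s = ψ (b i ⊗ₜ s) := fun i ψ s ↦ rfl
  let Ψ : CharacterModule (A ⊗[R] S) → A ⊗[R] CharacterModule S := fun ψ ↦ ∑ i, b' i ⊗ₜ[R] χ i ψ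
  have hΨadd : ∀ ψ₁ ψ₂, Ψ (ψ₁ + ψ₂) = Ψ ψ₁ + Ψ ψ₂ := by
    intro ψ₁ ψ₂
    simp only [Ψ, ← Finset.sum_add_distrib, ← TensorProduct.tmul_add]
    refine Finset.sum_congr rfl fun i _ ↦ ?_
    congr 1
  have hΨzero : Ψ 0 = 0 := by
    have h := hΨadd 0 0
    rw [add_zero] at h
    exact left_eq_add.mp h
  -- `Ψ ∘ Φ = id`
  have hleft : ∀ z, Ψ (Φ z) = z := by
    intro z
    induction z using TensorProduct.induction_on with
    | zero => rw [map_zero, hΨzero]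
    | add z₁ z₂ h₁ h₂ => rw [map_add, hΨadd, h₁, h₂]
    | tmul a x =>
      have hχi : ∀ i, χ i (Φ (a ⊗ₜ x)) = t (a * b i) • x := by
        intro i
        refine DFunLike.ext _ _ fun s ↦ ?_
        rw [hχ, hΦ, CharacterModule.smul_apply]
      simp only [Ψ, hχi, ← TensorProduct.smul_tmul, ← TensorProduct.sum_tmul]
      rw [← hb' a]
  -- evaluation of a finite sum of characters
  have hsum : ∀ (f : ι → CharacterModule (A ⊗[R] S)) (w : A ⊗[R] S), (∑ i, f i) w = ∑ i, f i w :=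
    fun f w ↦ AddMonoidHom.finsetSum_apply f Finset.univ w
  -- `Φ ∘ Ψ = id`
  have hright : ∀ ψ, Φ (Ψ ψ) = ψ := by
    intro ψ
    have hΦΨ : Φ (Ψ ψ) = ∑ i, Φ (b' i ⊗ₜ[R] χ i ψ) := by simp only [Ψ, map_sum]
    refine DFunLike.ext _ _ fun w ↦ ?_
    induction w using TensorProduct.induction_on with
    | zero => simp
    | add w₁ w₂ h₁ h₂ => simp only [map_add, h₁, h₂]
    | tmul a' s =>
      have hexp : ∑ i, t (b' i * a') • b i = a' := by
        conv_rhs => rw [hb a']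
        exact Finset.sum_congr rfl fun i _ ↦ by rw [mul_comm]
      rw [hΦΨ, hsum]
      simp only [hΦ, hχ, ← TensorProduct.smul_tmul]
      rw [← map_sum ψ, ← TensorProduct.sum_tmul, hexp]
  exact ⟨LinearEquiv.mk Φ Ψ hleft hright, hΦ⟩

/-- **The same, stated as `X(A ⊗_R S) ≃ₗ[A] A ⊗_R X(S)`** (the direction the Road-FF consumer uses: the Selmer dual of
the coefficient-extended representation IS the base change of the Selmer dual). [folklore] -/
theorem nonempty_characterModule_baseChange_equiv {ι : Type*} [Fintype ι] (t : A →ₗ[R] R) (b b' : ι → A)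
    (hb : ∀ a : A, a = ∑ i, t (a * b' i) • b i) (hb' : ∀ a : A, a = ∑ i, t (a * b i) • b' i) :
    Nonempty (CharacterModule (A ⊗[R] S) ≃ₗ[A] A ⊗[R] CharacterModule S) := by
  obtain ⟨e, -⟩ := exists_characterModule_baseChange_equiv (S := S) t b b' hb hb'
  exact ⟨e.symm⟩


/-! ### Frobenius data lift from `𝒪 → 𝒪'` to the power-series rings `𝒪⟦T⟧ → 𝒪'⟦T⟧` -/

section PowerSeriesLift

open PowerSeries

variable {ι : Type*} [Fintype ι]

/-- **Frobenius data lift coefficientwise to power series.** If `t₀ : A → R` and `b, b' : ι → A` are Frobenius data for the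
`R`-algebra `A` (mutually dual finite families for `(x, y) ↦ t₀(xy)`), then the coefficientwise extension
`t(Σ f_n T^n) = Σ t₀(f_n) T^n` and the constant families `C ∘ b`, `C ∘ b'` are Frobenius data for the `R⟦T⟧`-algebra `A⟦T⟧`
(Mathlib's `PowerSeries.algebraPowerSeries`, `g • f = (map g)·f`). The case the Road-FF consumer uses: `R = ℤ_p⟦T⟧ = Λ`,
`A = 𝒪_m⟦T⟧`. [folklore] -/
theorem exists_frobeniusData_powerSeries (t₀ : A →ₗ[R] R) (b b' : ι → A)
    (hb : ∀ a : A, a = ∑ i, t₀ (a * b' i) • b i) (hb' : ∀ a : A, a = ∑ i, t₀ (a * b i) • b' i) :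
    ∃ t : A⟦X⟧ →ₗ[R⟦X⟧] R⟦X⟧, (∀ (f : A⟦X⟧) (n : ℕ), coeff n (t f) = t₀ (coeff n f)) ∧
      (∀ f : A⟦X⟧, f = ∑ i, t (f * C (b' i)) • C (b i)) ∧
      (∀ f : A⟦X⟧, f = ∑ i, t (f * C (b i)) • C (b' i)) := by
  classical
  -- the coefficientwise extension, as an additive map
  let tf : A⟦X⟧ → R⟦X⟧ := fun f ↦ PowerSeries.mk fun n ↦ t₀ (coeff n f)
  have htf : ∀ f n, coeff n (tf f) = t₀ (coeff n f) := fun f n ↦ by simp [tf]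
  have hadd : ∀ f g, tf (f + g) = tf f + tf g := fun f g ↦ by
    ext n; simp [htf]
  -- `R⟦T⟧`-linearity: `t((map g)·f) = g·t(f)` coefficient by coefficient
  have hsmul : ∀ (g : R⟦X⟧) (f : A⟦X⟧), tf (g • f) = g • tf f := by
    intro g f
    ext n
    rw [Algebra.smul_def, PowerSeries.algebraMap_apply'', smul_eq_mul, htf, coeff_mul, coeff_mul, map_sum]
    refine Finset.sum_congr rfl fun x _ ↦ ?_
    rw [coeff_map, ← Algebra.smul_def, map_smul, smul_eq_mul, htf]
  let t : A⟦X⟧ →ₗ[R⟦X⟧] R⟦X⟧ := { toFun := tf, map_add' := hadd, map_smul' := hsmul }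
  have ht : ∀ f n, coeff n (t f) = t₀ (coeff n f) := htf
  -- the two expansions, coefficient by coefficient
  have hexp : ∀ (c c' : ι → A), (∀ a : A, a = ∑ i, t₀ (a * c' i) • c i) →
      ∀ f : A⟦X⟧, f = ∑ i, t (f * C (c' i)) • C (c i) := by
    intro c c' hc f
    ext n
    rw [map_sum]
    conv_lhs => rw [hc (coeff n f)]
    refine Finset.sum_congr rfl fun i _ ↦ ?_
    rw [Algebra.smul_def (t (f * C (c' i))) (C (c i)), PowerSeries.algebraMap_apply'', coeff_mul_C, coeff_map, ht,
      coeff_mul_C, ← Algebra.smul_def]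
  exact ⟨t, ht, hexp b b' hb, hexp b' b hb'⟩

end PowerSeriesLift


section PowerSeriesBaseChange

open PowerSeries

variable {ι : Type*} [Fintype ι]

/-- **The Road-FF shape: for Frobenius data on `𝒪 → 𝒪'` and ANY `𝒪⟦T⟧`-module `S`,
`X(𝒪'⟦T⟧ ⊗_{𝒪⟦T⟧} S) ≃ₗ[𝒪'⟦T⟧] 𝒪'⟦T⟧ ⊗_{𝒪⟦T⟧} X(S)`** (the two previous results composed). With `𝒪 = ℤ_p`,
`𝒪' = 𝒪_m` (a member's coefficient ring), `S = Sel^Σ(K, M_f)` and stages (β)–(δ) (`Sel^Σ(K, M_f ⊗ 𝒪') ≅ 𝒪'⟦T⟧ ⊗ Sel^Σ(K, M_f)`)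
this is the binder `e_m`'s coefficient half `X^Σ_{𝒪'}(E ⊗ 𝒪') ≅ 𝒪'⟦T⟧ ⊗_Λ X^Σ(E)`. [folklore]
[cite: Skinner2016PacificMC, §2.6 (2-6-1) (the coefficient extension `T_f ⊗ 𝒪`)] -/
theorem nonempty_characterModule_powerSeries_baseChange_equiv (t₀ : A →ₗ[R] R) (b b' : ι → A)
    (hb : ∀ a : A, a = ∑ i, t₀ (a * b' i) • b i) (hb' : ∀ a : A, a = ∑ i, t₀ (a * b i) • b' i)
    (S' : Type*) [AddCommGroup S'] [Module R⟦X⟧ S'] :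
    Nonempty (CharacterModule (A⟦X⟧ ⊗[R⟦X⟧] S') ≃ₗ[A⟦X⟧] A⟦X⟧ ⊗[R⟦X⟧] CharacterModule S') := by
  classical
  obtain ⟨t, -, h1, h2⟩ := exists_frobeniusData_powerSeries t₀ b b' hb hb'
  exact nonempty_characterModule_baseChange_equiv (S := S') t (fun i ↦ C (b i)) (fun i ↦ C (b' i)) h1 h2

end PowerSeriesBaseChange

end Summit.BirchSwinnertonDyer.Rank1Residual.X11b.CoeffBaseChange

end
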